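import Summits.ResolutionOfSingularities.ResolutionOfSingularities.Theorems.WeightedInvariantJOpenPresentationLE3AssemblyNamed
import Summits.ResolutionOfSingularities.ResolutionOfSingularities.Theorems.WeightedInvariantTieFinitePrimesOver
import HarnessLib

/-!
# INPUT (T) OF THE (open″)≤3 ASSEMBLY, CLOSED: `JOpenLE3.tieFreeAlongCurveLE3 p : TieFreeAlongCurveLE3 p`, and h8 from the three
# point bodies alone (door `HypersurfaceCentreConstruction`, stmt-ResolutionOfSingularities-19897; P3 rung clause h8
# `JOpenPresentationForallSingLE 3 p Iota3.iotaFlatT Iota3.jFlatT`; KEY (o52-T) / SPEC (Δ10) of res-L1-w43-plan-1; hand res-D-brk-1)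

Topic: `Summits/ResolutionOfSingularities/ResolutionOfSingularities/Theorems`. Helper for the door item
`HypersurfaceCentreConstruction` (stmt-ResolutionOfSingularities-19897, route `WeightedInvariant`), line `local-engine`
(L W4.3), def-free.  The ten-line closer announced with the (Δ10-e) glue: res-D-brk-1's `JOpenLE3.tieFreeAlongCurveLE3_of_finite`
(p557074) applied to the KEY finiteness `TieFinite.finite_tiePrimes_over` ((Δ10-d), `…TieFinitePrimesOver`) gives the tie-freeness
input (T) `JOpenLE3.TieFreeAlongCurveLE3 p` of the regime assembly OUTRIGHT, for every `p`; hence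
`JOpenPresentationForallSingLE 3 p iotaFlatT jFlatT` follows from the three point bodies `PointBodyLE3 p 0 0` (ISOLATED),
`PointBodyLE3 p 0 1` (TIE), `PointBodyLE3 p 1 0` (CROSSING) alone (`jOpenPresentationForallSingLE_three_of_points`).

[OURS · L1 W4.3 · (o52-T)]  Replaces the role of NO printed item; NOT a statement of the manuscript
[claim: Hironaka2017, status: under-review]. AI work, weaker than expert review.  Pure commutative algebra; no named facts.

## References

* D. Abramovich, M. H. Quek, B. Schober, arXiv:2507.01232 (2025), Thm 1.3 (3), Thm 3.5. [AbramovichQuekSchober2025]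
* res-L1-w43-plan-1, KEY (o52-T), SPEC (Δ10) rev 3, REGISTRAR RULING #13 (OURS, AI planning).
-/

noncomputable section

open IsLocalRing Literature.AlgebraicGeometry.Resolution
open Summit.ResolutionOfSingularities.ResolutionOfSingularities.Cruxes.HypersurfaceCentreConstruction.LocalEngine
open Summit.ResolutionOfSingularities.ResolutionOfSingularities.Cruxes.HypersurfaceCentreConstruction.LocalEngine.Iota3
open Summit.ResolutionOfSingularities.ResolutionOfSingularities.Cruxes.HypersurfaceCentreConstruction.LocalEngine.TieFinite

set_option linter.dupNamespace false -- mandated namespace of this single-conjunct summit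

namespace Summit.ResolutionOfSingularities.ResolutionOfSingularities.Theorems

namespace JOpenLE3

/-- **INPUT (T) OF THE (open″)≤3 ASSEMBLY HOLDS**: tie-freeness along every height-two equimultiple stratum, dimension `≤ 3`
(the (Δ10-e) glue applied to the KEY finiteness `TieFinite.finite_tiePrimes_over`). [OURS · L1 W4.3 · (o52-T)] -/
theorem tieFreeAlongCurveLE3 (p : ℕ) : TieFreeAlongCurveLE3 p :=
  tieFreeAlongCurveLE3_of_finite p fun k₀ _ _ A _ _ _ F 𝔭 _ _ hdim hF0 hF2 =>
    finite_tiePrimes_over k₀ A F 𝔭 hdim hF0 hF2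

/-- **h8 FROM THE THREE POINT BODIES ALONE**: `PointBodyLE3 p 0 0` (ISOLATED), `PointBodyLE3 p 0 1` (TIE) and `PointBodyLE3 p 1 0`
(CROSSING) give `JOpenPresentationForallSingLE 3 p iotaFlatT jFlatT`. [OURS · L1 W4.3 · (o52-asm)/(o52-T)] -/
theorem jOpenPresentationForallSingLE_three_of_points (p : ℕ)
    (hP00 : PointBodyLE3 p 0 0) (hP01 : PointBodyLE3 p 0 1) (hP10 : PointBodyLE3 p 1 0) :
    JOpenPresentationForallSingLE 3 p iotaFlatT jFlatT :=
  jOpenPresentationForallSingLE_three_of_bodies p (tieFreeAlongCurveLE3 p) hP00 hP01 hP10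

/-- The same with the point regimes bundled as `∀ e t, PointBodyLE3 p e t`. [OURS · L1 W4.3 · (o52-asm)] -/
theorem jOpenPresentationForallSingLE_three_of_pointBody' (p : ℕ) (hP : ∀ e t : Ordinal.{0}, PointBodyLE3 p e t) :
    JOpenPresentationForallSingLE 3 p iotaFlatT jFlatT :=
  jOpenPresentationForallSingLE_three_of_points p (hP 0 0) (hP 0 1) (hP 1 0)

end JOpenLE3

end Summit.ResolutionOfSingularities.ResolutionOfSingularities.Theorems

end
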